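import Summits.CriticalPhenomena.PercolationContinuityZ3.Theorems.Transplant.SkelFrmQuasiBParamsSlotsTA
import Summits.CriticalPhenomena.PercolationContinuityZ3.Theorems.Transplant.SkelFrmBParamsSlotsTA
import Summits.CriticalPhenomena.PercolationContinuityZ3.Theorems.Transplant.SkelNegBParamsSlotsTA
import Summits.CriticalPhenomena.PercolationContinuityZ3.Theorems.Transplant.SkelFrmQuasiBParamsSchedA
import Summits.CriticalPhenomena.PercolationContinuityZ3.Theorems.Transplant.SkelFrmBParamsSchedA
import Summits.CriticalPhenomena.PercolationContinuityZ3.Theorems.Transplant.SkelPhiFaceRunN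
import Summits.CriticalPhenomena.PercolationContinuityZ3.Theorems.Transplant.SkelFrmFrom1SlotTypes
import Summits.CriticalPhenomena.PercolationContinuityZ3.Theorems.Transplant.SkelFrm1SlotTypes
import Summits.CriticalPhenomena.PercolationContinuityZ3.Theorems.Transplant.SkelFrmQuasi1ParamsPO
import Summits.CriticalPhenomena.PercolationContinuityZ3.Theorems.Transplant.SkelFrm1ParamsPO
import Summits.CriticalPhenomena.PercolationContinuityZ3.Theorems.Transplant.SkelFrmQuasi1ParamsLBL
import Summits.CriticalPhenomena.PercolationContinuityZ3.Theorems.Transplant.SkelFrm1ParamsLBL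
import Summits.CriticalPhenomena.PercolationContinuityZ3.Theorems.Transplant.SkelFrmFromBParamsKitA
import Summits.CriticalPhenomena.PercolationContinuityZ3.Theorems.Transplant.SkelFrmBParamsKitA
import Summits.CriticalPhenomena.PercolationContinuityZ3.Theorems.Transplant.SkelFrmQuasiBParamsKitS
import Summits.CriticalPhenomena.PercolationContinuityZ3.Theorems.Transplant.SkelFrmBParamsKitS
import Summits.CriticalPhenomena.PercolationContinuityZ3.Theorems.Transplant.SkelFrmQuasi1ParamsLF
import Summits.CriticalPhenomena.PercolationContinuityZ3.Theorems.Transplant.SkelFrm1ParamsLF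
import Summits.CriticalPhenomena.PercolationContinuityZ3.Theorems.Transplant.SkelFrmFrom1ParamsLO
import Summits.CriticalPhenomena.PercolationContinuityZ3.Theorems.Transplant.SkelFrm1ParamsLO
import Summits.CriticalPhenomena.PercolationContinuityZ3.Theorems.Transplant.SkelFrmQuasiBParamsLF
import Summits.CriticalPhenomena.PercolationContinuityZ3.Theorems.Transplant.SkelFrmBParamsLF
import Summits.CriticalPhenomena.PercolationContinuityZ3.Theorems.Transplant.SkelFrmQuasiBParamsFineSize
import Summits.CriticalPhenomena.PercolationContinuityZ3.Theorems.Transplant.SkelFrmBParamsFineSize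
import Summits.CriticalPhenomena.PercolationContinuityZ3.Theorems.Transplant.SkelFrmQuasiBParamsLFA
import Summits.CriticalPhenomena.PercolationContinuityZ3.Theorems.Transplant.SkelFrmBParamsLFA
import Summits.CriticalPhenomena.PercolationContinuityZ3.Theorems.Transplant.SkelFrmQuasiBParamsLO
import Summits.CriticalPhenomena.PercolationContinuityZ3.Theorems.Transplant.SkelFrmBParamsLO
import Summits.CriticalPhenomena.PercolationContinuityZ3.Theorems.Transplant.SkelFrmFromBParamsB
import Summits.CriticalPhenomena.PercolationContinuityZ3.Theorems.Transplant.SkelFrmBParamsB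
import Summits.CriticalPhenomena.PercolationContinuityZ3.Theorems.Transplant.SkelFrmQuasiBParamsFineSizeA
import Summits.CriticalPhenomena.PercolationContinuityZ3.Theorems.Transplant.SkelFrmBParamsFineSizeA
import Summits.CriticalPhenomena.PercolationContinuityZ3.Theorems.Transplant.SkelFrmFromBParamsSlotsR
import Summits.CriticalPhenomena.PercolationContinuityZ3.Theorems.Transplant.SkelFrmBParamsSlotsR
import Summits.CriticalPhenomena.PercolationContinuityZ3.Theorems.Transplant.SkelFrmQuasiBParamsSlotsRS
import Summits.CriticalPhenomena.PercolationContinuityZ3.Theorems.Transplant.SkelFrmBParamsSlotsRS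
import Summits.CriticalPhenomena.PercolationContinuityZ3.Theorems.Transplant.SkelFrmQuasiBParamsSlots
import Summits.CriticalPhenomena.PercolationContinuityZ3.Theorems.Transplant.SkelFrmBParamsSlots
import Summits.CriticalPhenomena.PercolationContinuityZ3.Theorems.Transplant.SkelFrmFromBParamsSched
import Summits.CriticalPhenomena.PercolationContinuityZ3.Theorems.Transplant.SkelFrmBParamsSched
import Summits.CriticalPhenomena.PercolationContinuityZ3.Theorems.Transplant.SkelFrmQuasiBParamsSlotsT
import Summits.CriticalPhenomena.PercolationContinuityZ3.Theorems.Transplant.SkelFrmBParamsSlotsT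
import Summits.CriticalPhenomena.PercolationContinuityZ3.Theorems.Transplant.SkelFrmFromBParamsReachFC
import Summits.CriticalPhenomena.PercolationContinuityZ3.Theorems.Transplant.SkelFrmBParamsReachFC
import Summits.CriticalPhenomena.PercolationContinuityZ3.Theorems.Transplant.SkelNegBParamsFaceLatA
import Summits.CriticalPhenomena.PercolationContinuityZ3.Theorems.Transplant.PlanarSkeletonFrmQuasiDefs
import Summits.CriticalPhenomena.PercolationContinuityZ3.Theorems.Transplant.PlanarSkeletonFrmDefs
import Summits.CriticalPhenomena.PercolationContinuityZ3.Theorems.Transplant.SkelPhiStepIDataNS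
import Summits.CriticalPhenomena.PercolationContinuityZ3.Theorems.Transplant.SkelFrmQuasi1ChoiceDefs
import Summits.CriticalPhenomena.PercolationContinuityZ3.Theorems.Transplant.SkelFrmQuasiBChoiceDefs
import Summits.CriticalPhenomena.PercolationContinuityZ3.Theorems.Transplant.SkelFrmQuasi1SlotTypes
import HarnessLib
import Summits.CriticalPhenomena.PercolationContinuityZ3.Theorems.Transplant.SkelFrmBParamsFaceLatA
/-!
# GEN-Q PORT (WAVE-Q table v0.8 section 2, row G103, U-level L13; captain R-6/R-7 2026-08-27: carrier token swap `PlanarSkeletonFrmFrom ↦ PlanarSkeletonFrmQuasi`)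
# of the tree module «Transplant/SkelFrmFromBParamsFaceLatA» (sha256 4d2e1b819f6c6374…) onto the quasi-step carrier `PlanarSkeletonFrmQuasi` (p507026): «SkelFrmQuasiBParamsFaceLatA»

ORIGINAL TITLE: N2 (frames-only node `SamePDropOfSkeletonFrmFrom₁`, OPEN) params column over `PlanarSkeletonFrm` — (ζ″) ledger, shape (B′) of record ((R-14)):

builds on p205010 (kernel theorem, internal audit signed; external expert review pending) — nothing in this file uses p205010; NOTHING is claimed about any open node
((N3-b), the end state).  Lane `prim-bschramm`, seat `prim-bschramm-stmt` (gen 33; GEN-Q column pen; tool = captain gen-1 g4's port_genq.py R-14 --cone + p3-g30's T1 patch).  Helper file (`--supports stmt-CriticalPhenomena-4575 --as helper`).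
PORT RULES (U-wave r1–r4 re-used, GEN-Q hunk classes of p3-g29 #6136): declaration order, names and proof texts are those of «SkelFrmFromBParamsFaceLatA», byte-identical except
(i) the carrier token `PlanarSkeletonFrmFrom ↦ PlanarSkeletonFrmQuasi` in binders, `namespace`/`end` lines and qualified names (module names `SkelFrmFrom… ↦ SkelFrmQuasi…`
in imports of already-ported rows); (ii) `Φ.step ↦ Φ.qstep` with the called Steps lemma replaced by its `…Q`/`_q` twin and the cost `Φ.M` threaded (none in this file unless
listed below); (iii) `Φ.cyl_connected ↦ Φ.cyl_reach` readers (none unless listed); (iv) graph-ball radii / window floors ×`Φ.M` (none unless listed).  Carrier-free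
residents stay imported/exported from the original «SkelFrmBParamsFaceLatA» exactly as in the FrmFrom port.  Docstrings and citations are the original's.

-/

noncomputable section

open scoped Classical

namespace Summit.CriticalPhenomena.PercolationContinuityZ3.Theorems.Transplant

namespace PlanarSkeletonFrmQuasi

namespace NegB

open Literature.Probability.Percolation Literature.Probability.LatticeModels SimpleGraph
open SkelConc (Consts)
open Skelφ.StepI (DataN)
open TwoAxis.Para (modulus)
open Literature.Probability.Percolation.KozmaNitzan.Cells (oth)
open Neg

section Lat

/-! ## §1 The lattice bounds -/

/-- `prFA.L 0 = A·L̂₀` and `prFA.L 1 = A·L̂₁`. [folklore] -/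
theorem L_eqA (κ : Consts) {V : Type} [DecidableEq V] [Countable V] {G : SimpleGraph V} [G.LocallyFinite] (Φ : PlanarSkeletonFrmQuasi G) (t : V) (p : unitInterval) (D : Skelφ.StepI.DataNS V) (g : ℕ) (f : ℕ) :
    (prFA κ Φ t p D g f).L 0 = Aof κ * Skelφ.NegPrm.L0hat (nL κ Φ t p D g f) (hL κ Φ t p D g f) (ℓL κ Φ t p D g f) (vL κ Φ t p D g f) ∧
      (prFA κ Φ t p D g f).L 1 = Aof κ * Skelφ.NegPrm.L1hat (nL κ Φ t p D g f) (hL κ Φ t p D g f) := by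
  obtain ⟨hA, hn, hh, hvα, hvβ, -, -, -⟩ := prFA_fields κ Φ t p D g f
  have hn0 : (0 : ℤ) ≤ (nL κ Φ t p D g f : ℤ) := Nat.cast_nonneg _
  have hA0 : 0 ≤ Aof κ := (Aof_pos κ).1.le
  rw [Skelφ.FinePrm.L_zero, Skelφ.FinePrm.L_one, hA, hn, hh, hvα, hvβ, abs_of_nonneg hA0, abs_of_nonneg hn0]
  unfold Skelφ.NegPrm.L0hat Skelφ.NegPrm.L1hat vβL
  exact ⟨by ring, rfl⟩

/-- **Upper**: `c_I·L_I + 2 ≤ D_A` (`prFA_room`). [folklore] -/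
theorem cL_upperA (κ : Consts) {V : Type} [DecidableEq V] [Countable V] {G : SimpleGraph V} [G.LocallyFinite] (Φ : PlanarSkeletonFrmQuasi G) (t : V) (p : unitInterval) (D : Skelφ.StepI.DataNS V) (g : ℕ) (f : ℕ) (hN : EqNumL κ Φ t p D g f) (I : Fin 2) : (prFA κ Φ t p D g f).cOf I * (prFA κ Φ t p D g f).L I + 2 ≤ (prFA κ Φ t p D g f).D := by
  obtain ⟨h0, h1⟩ := prFA_room κ Φ t p D g f hN
  obtain rfl | rfl : I = 0 ∨ I = 1 := by fin_cases I <;> simp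
  · rwa [Skelφ.FinePrm.cOf_zero]
  · rwa [Skelφ.FinePrm.cOf_one]

/-- **Lower**: `11·D_A < 13·(c_I·L_I)` whenever `11 ≤ s_I` (from `modulus < (m^A_I+1)·L̂_I`, `D_A = A²·modulus`, `c_I·L_I = A·s_I·A·L̂_I`, `s_I = m^A_I − 1`).
[folklore] -/
theorem cL_lowerA (κ : Consts) {V : Type} [DecidableEq V] [Countable V] {G : SimpleGraph V} [G.LocallyFinite] (Φ : PlanarSkeletonFrmQuasi G) (t : V) (p : unitInterval) (D : Skelφ.StepI.DataNS V) (g : ℕ) (f : ℕ) (hN : EqNumL κ Φ t p D g f) (I : Fin 2) (hs : 11 ≤ (fcellsA κ Φ t p D g f).s I) :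
    11 * (prFA κ Φ t p D g f).D < 13 * ((prFA κ Φ t p D g f).cOf I * (prFA κ Φ t p D g f).L I) := by
  obtain ⟨hL0, hL1⟩ := L_eqA κ Φ t p D g f
  obtain ⟨-, -, -, -, -, -, -, hD⟩ := prFA_fields κ Φ t p D g f
  obtain ⟨hc0, hc1⟩ := prFA_c_eq κ Φ t p D g f
  have hAf : (prFA κ Φ t p D g f).A = Aof κ := (prFA_fields κ Φ t p D g f).1
  obtain ⟨hs0, hs1⟩ := fcellsA_s_at κ Φ t p D g f hN
  obtain ⟨hlt0, hlt1⟩ := modulus_lt_mA κ Φ t p D g f hN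
  have hDe : (prFA κ Φ t p D g f).D = Aof κ ^ 2 * modulus (nL κ Φ t p D g f) (hL κ Φ t p D g f) (vL κ Φ t p D g f) (vβL κ Φ t p D g f) := by
    rw [hD, Skelφ.NegPrm.DofA_eq]; rfl
  have hA2 : 0 < Aof κ ^ 2 := pow_pos (Aof_pos κ).1 2
  have hL0nn := Skelφ.NegPrm.Lhat_nonneg (nL κ Φ t p D g f) (hL κ Φ t p D g f) (ℓL κ Φ t p D g f) (vL κ Φ t p D g f)
  obtain rfl | rfl : I = 0 ∨ I = 1 := by fin_cases I <;> simp
  · rw [Skelφ.FinePrm.cOf_zero, hc0, hAf, hL0, hDe]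
    have hs' : (11 : ℤ) ≤ (((fcellsA κ Φ t p D g f).s 0 : ℕ) : ℤ) := by exact_mod_cast hs
    have e : m0A κ Φ t p D g f = (((fcellsA κ Φ t p D g f).s 0 : ℕ) : ℤ) + 1 := by rw [hs0]; unfold fm0A; ring
    rw [e] at hlt0
    set s : ℤ := (((fcellsA κ Φ t p D g f).s 0 : ℕ) : ℤ) with hsdef
    set Lh := Skelφ.NegPrm.L0hat (nL κ Φ t p D g f) (hL κ Φ t p D g f) (ℓL κ Φ t p D g f) (vL κ Φ t p D g f) with hLh
    set md := modulus (nL κ Φ t p D g f) (hL κ Φ t p D g f) (vL κ Φ t p D g f) (vβL κ Φ t p D g f) with hmd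
    have h1 : 11 * md < 11 * ((s + 1 + 1) * Lh) := by linarith
    have h2 : 11 * ((s + 1 + 1) * Lh) ≤ 13 * (s * Lh) := by nlinarith [hL0nn.1]
    have h3 : 11 * md < 13 * (s * Lh) := lt_of_lt_of_le h1 h2
    have h4 : Aof κ ^ 2 * (11 * md) < Aof κ ^ 2 * (13 * (s * Lh)) := mul_lt_mul_of_pos_left h3 hA2
    have e2 : 13 * (Aof κ * s * (Aof κ * Lh)) = Aof κ ^ 2 * (13 * (s * Lh)) := by ring
    rw [e2]; linarith
  · rw [Skelφ.FinePrm.cOf_one, hc1, hAf, hL1, hDe]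
    have hs' : (11 : ℤ) ≤ (((fcellsA κ Φ t p D g f).s 1 : ℕ) : ℤ) := by exact_mod_cast hs
    have e : m1A κ Φ t p D g f = (((fcellsA κ Φ t p D g f).s 1 : ℕ) : ℤ) + 1 := by rw [hs1]; unfold fm1A; ring
    rw [e] at hlt1
    set s : ℤ := (((fcellsA κ Φ t p D g f).s 1 : ℕ) : ℤ) with hsdef
    set Lh := Skelφ.NegPrm.L1hat (nL κ Φ t p D g f) (hL κ Φ t p D g f) with hLh
    set md := modulus (nL κ Φ t p D g f) (hL κ Φ t p D g f) (vL κ Φ t p D g f) (vβL κ Φ t p D g f) with hmd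
    have h1 : 11 * md < 11 * ((s + 1 + 1) * Lh) := by linarith
    have h2 : 11 * ((s + 1 + 1) * Lh) ≤ 13 * (s * Lh) := by nlinarith [hL0nn.2]
    have h3 : 11 * md < 13 * (s * Lh) := lt_of_lt_of_le h1 h2
    have h4 : Aof κ ^ 2 * (11 * md) < Aof κ ^ 2 * (13 * (s * Lh)) := mul_lt_mul_of_pos_left h3 hA2
    have e2 : 13 * (Aof κ * s * (Aof κ * Lh)) = Aof κ ^ 2 * (13 * (s * Lh)) := by ring
    rw [e2]; linarith

/-- **The raw axis carries half the generator**: `c_I·L_I ≤ 2A·rdK I (bOf I)` (`L_I = A·(|lv 0|+|lv 1|)`, `|lv (bOf I)| ≥ |lv (oth (bOf I))|`). [folklore] -/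
theorem rdK_lowerA (κ : Consts) {V : Type} [DecidableEq V] [Countable V] {G : SimpleGraph V} [G.LocallyFinite] (Φ : PlanarSkeletonFrmQuasi G) (t : V) (p : unitInterval) (D : Skelφ.StepI.DataNS V) (g : ℕ) (f : ℕ) (I : Fin 2) : (prFA κ Φ t p D g f).cOf I * (prFA κ Φ t p D g f).L I ≤ 2 * Aof κ * (prFA κ Φ t p D g f).rdK I ((prFA κ Φ t p D g f).bOf I) := by
  set pr := prFA κ Φ t p D g f
  have hA : pr.A = Aof κ := (prFA_fields κ Φ t p D g f).1
  have hA0 : 0 ≤ Aof κ := (Aof_pos κ).1.le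
  have hb := pr.abs_lvGen_oth_bOf_le I
  have hc : 0 ≤ pr.cOf I := (pr.cOf_pos (prFA_c_pos κ Φ t p D g f).1 (prFA_c_pos κ Φ t p D g f).2 I).le
  unfold Skelφ.FinePrm.rdK Skelφ.FinePrm.L
  rw [hA, abs_of_nonneg hA0]
  have hsum : |pr.lvGen I 0| + |pr.lvGen I 1| ≤ 2 * |pr.lvGen I (pr.bOf I)| := by
    have : pr.bOf I = 0 ∨ pr.bOf I = 1 := by
      generalize pr.bOf I = b; fin_cases b <;> simp
    rcases this with h0 | h1
    · rw [h0] at hb ⊢; have : oth (0 : Fin 2) = 1 := rfl; rw [this] at hb; linarith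
    · rw [h1] at hb ⊢; have : oth (1 : Fin 2) = 0 := rfl; rw [this] at hb; linarith
  have hcA : 0 ≤ pr.cOf I * Aof κ := mul_nonneg hc hA0
  calc pr.cOf I * (Aof κ * (|pr.lvGen I 0| + |pr.lvGen I 1|)) = (pr.cOf I * Aof κ) * (|pr.lvGen I 0| + |pr.lvGen I 1|) := by ring
    _ ≤ (pr.cOf I * Aof κ) * (2 * |pr.lvGen I (pr.bOf I)|) := mul_le_mul_of_nonneg_left hsum hcA
    _ = 2 * Aof κ * (pr.cOf I * |pr.lvGen I (pr.bOf I)|) := by ring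

/-- **The other generator is at most `D_A/A`**: `A·rdN I b ≤ D_A` for every `b`. [folklore] -/
theorem rdN_upperA (κ : Consts) {V : Type} [DecidableEq V] [Countable V] {G : SimpleGraph V} [G.LocallyFinite] (Φ : PlanarSkeletonFrmQuasi G) (t : V) (p : unitInterval) (D : Skelφ.StepI.DataNS V) (g : ℕ) (f : ℕ) (hN : EqNumL κ Φ t p D g f) (I b : Fin 2) : Aof κ * (prFA κ Φ t p D g f).rdN I b ≤ (prFA κ Φ t p D g f).D := by
  set pr := prFA κ Φ t p D g f
  have hA : pr.A = Aof κ := (prFA_fields κ Φ t p D g f).1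
  have hA0 : 0 ≤ Aof κ := (Aof_pos κ).1.le
  have hJ := cL_upperA κ Φ t p D g f hN (oth I)
  have hc : 0 ≤ pr.cOf (oth I) := (pr.cOf_pos (prFA_c_pos κ Φ t p D g f).1 (prFA_c_pos κ Φ t p D g f).2 (oth I)).le
  have hle : |pr.lvGen (oth I) b| ≤ |pr.lvGen (oth I) 0| + |pr.lvGen (oth I) 1| := by
    obtain rfl | rfl : b = 0 ∨ b = 1 := by fin_cases b <;> simp
    · linarith [abs_nonneg (pr.lvGen (oth I) 1)]
    · linarith [abs_nonneg (pr.lvGen (oth I) 0)]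
  have hL : pr.L (oth I) = Aof κ * (|pr.lvGen (oth I) 0| + |pr.lvGen (oth I) 1|) := by
    unfold Skelφ.FinePrm.L; rw [hA, abs_of_nonneg hA0]
  unfold Skelφ.FinePrm.rdN
  rw [hL] at hJ
  have hcA : 0 ≤ pr.cOf (oth I) * Aof κ := mul_nonneg hc hA0
  calc Aof κ * (pr.cOf (oth I) * |pr.lvGen (oth I) b|) = (pr.cOf (oth I) * Aof κ) * |pr.lvGen (oth I) b| := by ring
    _ ≤ (pr.cOf (oth I) * Aof κ) * (|pr.lvGen (oth I) 0| + |pr.lvGen (oth I) 1|) := mul_le_mul_of_nonneg_left hle hcA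
    _ = pr.cOf (oth I) * (Aof κ * (|pr.lvGen (oth I) 0| + |pr.lvGen (oth I) 1|)) := by ring
    _ ≤ pr.D := by linarith

/-- **`A·Mabs = c₀·c₁·D_A`** (`D_A = A²·modulus`, `modulus > 0`, `A > 0`). [folklore] -/
theorem Mabs_eqA (κ : Consts) {V : Type} [DecidableEq V] [Countable V] {G : SimpleGraph V} [G.LocallyFinite] (Φ : PlanarSkeletonFrmQuasi G) (t : V) (p : unitInterval) (D : Skelφ.StepI.DataNS V) (g : ℕ) (f : ℕ) (hN : EqNumL κ Φ t p D g f) : Aof κ * (prFA κ Φ t p D g f).Mabs = (prFA κ Φ t p D g f).c₀ * (prFA κ Φ t p D g f).c₁ * (prFA κ Φ t p D g f).D := by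
  set pr := prFA κ Φ t p D g f
  obtain ⟨hA, hn, hh, hvα, hvβ, -, -, hD⟩ := prFA_fields κ Φ t p D g f
  obtain ⟨hn1, hℓ1⟩ := one_le_of_eqNumL κ Φ t p D g f hN
  have hm : 0 < modulus (nL κ Φ t p D g f) (hL κ Φ t p D g f) (vL κ Φ t p D g f) (vβL κ Φ t p D g f) :=
    Skelφ.NegPrm.modulus_vβOf_pos hn1 hℓ1 _ _
  have hDe : pr.D = Aof κ ^ 2 * modulus (nL κ Φ t p D g f) (hL κ Φ t p D g f) (vL κ Φ t p D g f) (vβL κ Φ t p D g f) := by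
    rw [hD, Skelφ.NegPrm.DofA_eq]; rfl
  unfold Skelφ.FinePrm.Mabs
  rw [hA, hn, hh, hvα, hvβ, hDe]
  change Aof κ * (pr.c₀ * pr.c₁ * |Aof κ * modulus (nL κ Φ t p D g f) (hL κ Φ t p D g f) (vL κ Φ t p D g f) (vβL κ Φ t p D g f)|) = _
  rw [abs_of_pos (mul_pos (Aof_pos κ).1 hm)]
  ring

/-! ## §2 The first consequence: the `k₀` ceiling is at most `3`, and `hk₀'` -/

/-- `0 < rdK I (bOf I)` at the (ζ′) frame record. [folklore] -/
theorem rdK_pos_RA (κ : Consts) {V : Type} [DecidableEq V] [Countable V] {G : SimpleGraph V} [G.LocallyFinite] (Φ : PlanarSkeletonFrmQuasi G) (t : V) (p : unitInterval) (D : Skelφ.StepI.DataNS V) (g : ℕ) (f : ℕ) (hN : EqNumL κ Φ t p D g f) (I : Fin 2) : 0 < (prFA κ Φ t p D g f).rdK I ((prFA κ Φ t p D g f).bOf I) := by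
  set pr := prFA κ Φ t p D g f
  obtain ⟨hn1, hℓ1⟩ := one_le_of_eqNumL κ Φ t p D g f hN
  have hDpos : 0 < pr.D := by
    have e : pr.D = Skelφ.NegPrm.DofA (Aof κ) (nL κ Φ t p D g f) (hL κ Φ t p D g f) (ℓL κ Φ t p D g f) (vL κ Φ t p D g f) :=
      (prFA_fields κ Φ t p D g f).2.2.2.2.2.2.2
    rw [e]; exact Skelφ.NegPrm.DofA_pos (Aof_pos κ).2 hn1 hℓ1 _ _
  unfold Skelφ.FinePrm.rdK
  exact mul_pos (pr.cOf_pos (prFA_c_pos κ Φ t p D g f).1 (prFA_c_pos κ Φ t p D g f).2 I)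
    (abs_pos.2 (pr.lvGen_bOf_ne_zero I (pr.lvGen_ne_zero_of_detD_pos (prFA_D κ Φ t p D g f) hDpos I)))

-- GEN-Q (R-2, captain 2026-08-27): `PlanarSkeletonFrmFrom.NegB.k₀_ceil_le_threeA` is not in the used cone of the node top — not ported.

/-- `3·rdK ≥ rdN` in the product form hp-8's `hk₀` consumes. [folklore] -/
theorem rdN_le_three_rdKA (κ : Consts) {V : Type} [DecidableEq V] [Countable V] {G : SimpleGraph V} [G.LocallyFinite] (Φ : PlanarSkeletonFrmQuasi G) (t : V) (p : unitInterval) (D : Skelφ.StepI.DataNS V) (g : ℕ) (f : ℕ) (hN : EqNumL κ Φ t p D g f) (I : Fin 2) (hs : 11 ≤ (fcellsA κ Φ t p D g f).s I) :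
    (prFA κ Φ t p D g f).rdN I ((prFA κ Φ t p D g f).bOf I) ≤ (prFA κ Φ t p D g f).rdK I ((prFA κ Φ t p D g f).bOf I) * 3 := by
  have h1 := cL_lowerA κ Φ t p D g f hN I hs
  have h2 := rdK_lowerA κ Φ t p D g f I
  have h3 := rdN_upperA κ Φ t p D g f hN I ((prFA κ Φ t p D g f).bOf I)
  have hpos := rdK_pos_RA κ Φ t p D g f hN I
  have hA := (Aof_pos κ).1
  set N := (prFA κ Φ t p D g f).rdN I ((prFA κ Φ t p D g f).bOf I)
  set Kk := (prFA κ Φ t p D g f).rdK I ((prFA κ Φ t p D g f).bOf I)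
  have h4 : Aof κ * (11 * N) < Aof κ * (26 * Kk) := by nlinarith
  have h5 : 11 * N < 26 * Kk := lt_of_mul_lt_mul_left h4 hA.le
  linarith

/-- `11 ≤ s_i` at `g := KS.gT` for the (ζ′) cells (from `cells_geTA'`: `6·RA' + 11 ≤ s₀`, `14·RA' + 27 ≤ s₁`). [folklore] -/
theorem eleven_le_s_TA (κ : Consts) {V : Type} [DecidableEq V] [Countable V] {G : SimpleGraph V} [G.LocallyFinite] (Φ : PlanarSkeletonFrmQuasi G) (t : V) (p : unitInterval) (D : Skelφ.StepI.DataNS V) (f : ℕ) (mk : ℕ) (gx : Neg.FSlot) (hN : EqNumL κ Φ t p D (KS.gT mk gx κ Φ t p D) f)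
    (hκ : (hL κ Φ t p D (KS.gT mk gx κ Φ t p D) f).natAbs ≤ 10 * nL κ Φ t p D (KS.gT mk gx κ Φ t p D) f)
    (i : Fin 2) : 11 ≤ (fcellsA κ Φ t p D (KS.gT mk gx κ Φ t p D) f).s i := by
  obtain ⟨hs0, hs1⟩ := KS.cells_geTA' κ Φ t p D mk gx f hN hκ
  obtain rfl | rfl : i = 0 ∨ i = 1 := by fin_cases i <;> simp
  · have : (11 : ℤ) ≤ (((fcellsA κ Φ t p D (KS.gT mk gx κ Φ t p D) f).s 0 : ℕ) : ℤ) := by linarith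
    exact_mod_cast this
  · have : (11 : ℤ) ≤ (((fcellsA κ Φ t p D (KS.gT mk gx κ Φ t p D) f).s 1 : ℕ) : ℤ) := by linarith
    exact_mod_cast this

/-- **`hk₀'` AT THE (ζ′) VALUES** for any `k₀ ≤ 3` (`g := KS.gT`, any `f`): `∀ i, 3·r i + k₀ + 3 ≤ 5·r i` (`r_i = K·s_i ≥ 40·11`). [folklore] -/
theorem hk₀'_RA (κ : Consts) {V : Type} [DecidableEq V] [Countable V] {G : SimpleGraph V} [G.LocallyFinite] (Φ : PlanarSkeletonFrmQuasi G) (t : V) (p : unitInterval) (D : Skelφ.StepI.DataNS V) (f : ℕ) (mk : ℕ) (gx : Neg.FSlot) (hN : EqNumL κ Φ t p D (KS.gT mk gx κ Φ t p D) f)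
    (hκ : (hL κ Φ t p D (KS.gT mk gx κ Φ t p D) f).natAbs ≤ 10 * nL κ Φ t p D (KS.gT mk gx κ Φ t p D) f)
    {k₀ : ℤ} (hk : k₀ ≤ 3) (i : Fin 2) :
    3 * ((fcellsA κ Φ t p D (KS.gT mk gx κ Φ t p D) f).r i : ℤ) + k₀ + 3 ≤ 5 * ((fcellsA κ Φ t p D (KS.gT mk gx κ Φ t p D) f).r i : ℤ) := by
  have hs := eleven_le_s_TA κ Φ t p D f mk gx hN hκ i
  have hr := (fcellsA_K κ Φ t p D (KS.gT mk gx κ Φ t p D) f).2.2 i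
  have hK := (Neg.forty_le_K κ).1
  have : 440 ≤ (fcellsA κ Φ t p D (KS.gT mk gx κ Φ t p D) f).r i := by rw [hr]; nlinarith
  have : (440 : ℤ) ≤ ((fcellsA κ Φ t p D (KS.gT mk gx κ Φ t p D) f).r i : ℤ) := by exact_mod_cast this
  linarith

end Lat

end NegB

end PlanarSkeletonFrmQuasi

end Summit.CriticalPhenomena.PercolationContinuityZ3.Theorems.Transplant

end
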